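import Summits.NavierStokesRegularity.NavierStokesRegularity.Theses.TypeILiouville
import Summits.NavierStokesRegularity.NavierStokesRegularity.Theorems.PlaneEnergyCeilingPlanarEnergyAPrioriFloor
import Literature.Analysis.FluidPDE.TaoBoundedTotalSpeedProofs
import Literature.Analysis.FunctionSpaces.SobolevDomainProofs
import Mathlib.Analysis.SpecialFunctions.Integrals.Basic
import HarnessLib

/-!
# Hard core `NoTypeII` (stmt-NavierStokesRegularity-0056): the TOTAL-SPEED RUNG of the rate chain
# — bounded total speed on `[0, T)` and the linear rate `(T - t)‖u(t)‖_∞` frequently bounded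

Helper file (theorems only) for the Type-II-exclusion estimate programme (D-0081 §B), serving as the
BC5 rung of record (Foias–Guillopé–Temam 1981 / Tao 2013 Prop. 9.1 endpoint) for the rate-chain
candidates of the lens planners:

* lens `wuc` (STATUS 2026-08-26T17:27:03Z): `SeqTypeI_α := «every first Leray–Hopf/Schwartz blow-up
  has lim inf_{t↑T} (T - t)^α ‖u(t)‖_∞ < ∞»`, `α = 1` KNOWN — here as a kernel theorem on the frame of
  the hard core;
* lens `transfer` (STATUS 2026-08-26T17:23:27Z): `SupSpeedBudget_q`, `q = 1` = bounded total speed.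

Results, for a classical solution of unforced Navier–Stokes on `ℝ³ × [0, T)` which is Leray–Hopf
from its datum (NO decay, NO maximality needed):

* `kineticEnergy_le_of_isLerayHopfOn` (+ the tree's `PlanarEnergyAPriori.lintegral_enorm_sq_le_of_isLerayHopfOn`)
  — the energy of every slice is at most that of the datum (energy inequality from `0`, zero force);
* `exists_boundedTotalSpeed_Ico` — **bounded total speed on the half-open slab**: for every `ν > 0`
  there is `K > 0` (Tao's constant) with `∫₀ᵀ ‖u(t)‖_{L^∞} dt ≤ K (√E₀ T^{1/4} + E₀)`,
  `E₀ = ½‖u(0)‖₂²`, for EVERY such solution on `[0, T)` — the tree's `tao2011_boundedTotalSpeed_holds`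
  (closed slabs `[0, T']`, `T' < T`) and monotone convergence; in particular the total speed of a
  blow-up solution is finite (`lintegral_eLpNorm_top_lt_top_of_classical`);
* `lintegral_inv_sub_Ioo_eq_top` — `∫_{T-δ}^{T} dt/(T - t) = ∞`;
* `frequently_linearRate_of_classical` — **the `α = 1` rung**: for every `C > 0`, FREQUENTLY as
  `t ↑ T`, `‖u(t, x)‖ ≤ C/(T - t)` for all `x` (else `‖u(t)‖_∞ > C/(T - t)` on a final interval, whose
  integral diverges); equivalently `lim inf_{t↑T} (T - t)‖u(t)‖_∞ = 0 ≤ C`.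

WHAT THIS IS NOT: not NS and nothing about Type II: the linear rate `1/(T - t)` is far above Leray's
`1/√(T - t)`; this is the known endpoint of the rate chain, landed so that candidates `SeqTypeI_α`,
`α < 1`, have their BC5 witness by name. [folklore]
-/

noncomputable section

-- the summit and its single problem share the name (D-0017 nested layout)
set_option linter.dupNamespace false

open MeasureTheory Set Function Filter TopologicalSpace Metric
open scoped Topology NNReal ENNReal

namespace Summit.NavierStokesRegularity.NavierStokesRegularity.Theorems.TypeIliouvilleNoTypeII.RateChain

open Literature.Analysis Literature.Analysis.FluidPDE

variable {ν T : ℝ} {u : ℝ → EuclideanSpace ℝ (Fin 3) → EuclideanSpace ℝ (Fin 3)}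
  {p : ℝ → EuclideanSpace ℝ (Fin 3) → ℝ}

/-! ### Energy of the slices -/

/-- **The kinetic energy of every slice is at most that of the datum** (zero force, `ν ≥ 0`; energy
inequality from `s = 0` with the dissipation dropped). [cite: Leray1934, (5.2)] -/
theorem kineticEnergy_le_of_isLerayHopfOn (hLH : IsLerayHopfOn T ν 0 (u 0) u) (hν : 0 ≤ ν) {t : ℝ}
    (ht : t ∈ Icc 0 T) : VectorCalculus.kineticEnergy (u t) ≤ VectorCalculus.kineticEnergy (u 0) := by
  obtain ⟨G, -, hE⟩ := hLH.energy_ineq_zero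
  have h := hE t ht
  simp only [Pi.zero_apply, inner_zero_left, integral_zero, intervalIntegral.integral_zero,
    add_zero] at h
  have hD : 0 ≤ ν * (∫⁻ τ in Ioo 0 t, ∫⁻ x, ENNReal.ofReal (frobeniusNormSq (G τ x))).toReal :=
    mul_nonneg hν ENNReal.toReal_nonneg
  linarith

/-! ### Bounded total speed on the half-open slab -/

/-- **Bounded total speed on `[0, T)`** (Foias–Guillopé–Temam 1981; Tao 2013, Prop. 9.1): for every
`ν > 0` there is `K > 0` such that every classical solution of unforced Navier–Stokes on
`ℝ³ × [0, T)`, `T > 0`, which is Leray–Hopf from its datum, has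
`∫₀ᵀ ‖u(t)‖_{L^∞} dt ≤ K (√E₀ T^{1/4} + E₀)`, `E₀ = kineticEnergy (u 0)`.  Proof: the tree's
`tao2011_boundedTotalSpeed_holds` on the closed slabs `[0, T - T/(n+2)]` (where `u` is classical up
to the endpoint) with the energy of the slices bounded by that of the datum, and
`(0, T) = ⋃ₙ (0, T - T/(n+2))`. [cite: Tao2011, Prop. 9.1 + footnote 3] -/
theorem exists_boundedTotalSpeed_Ico (hν : 0 < ν) :
    ∃ K : ℝ, 0 < K ∧ ∀ (T : ℝ), 0 < T →
      ∀ (u : ℝ → EuclideanSpace ℝ (Fin 3) → EuclideanSpace ℝ (Fin 3))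
        (p : ℝ → EuclideanSpace ℝ (Fin 3) → ℝ),
      IsClassicalNSSolutionOn (Ico 0 T) ν 0 u p → IsLerayHopfOn T ν 0 (u 0) u →
      ∫⁻ t in Ioo 0 T, eLpNorm (u t) ∞ volume ≤
        ENNReal.ofReal (K * (Real.sqrt (VectorCalculus.kineticEnergy (u 0)) * T ^ (1 / 4 : ℝ) +
          VectorCalculus.kineticEnergy (u 0))) := by
  obtain ⟨K, hK, hspeed⟩ := tao2011_boundedTotalSpeed_holds hν
  refine ⟨K, hK, fun T hT u p hsol hLH => ?_⟩
  set E : ℝ := VectorCalculus.kineticEnergy (u 0) with hE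
  have hE0 : 0 ≤ E := kineticEnergy_nonneg (u 0)
  have hE₀ : ∫⁻ x, ‖u 0 x‖ₑ ^ 2 ≤ ENNReal.ofReal (2 * E) :=
    PlanarEnergyAPriori.lintegral_enorm_sq_le_of_isLerayHopfOn hLH hν.le ⟨le_rfl, hT.le⟩
  -- the exhausting closed slabs `[0, T - T/(n+2)]`
  set Tn : ℕ → ℝ := fun n => T - T / ((n : ℝ) + 2) with hTn
  have hTn_pos : ∀ n, 0 < Tn n := fun n => by
    have h1 : T / ((n : ℝ) + 2) < T := by
      rw [div_lt_iff₀ (by positivity)]; nlinarith [Nat.cast_nonneg (α := ℝ) n]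
    simp only [hTn]; linarith
  have hTn_lt : ∀ n, Tn n < T := fun n => by
    have : 0 < T / ((n : ℝ) + 2) := by positivity
    simp only [hTn]; linarith
  have hTn_mono : Monotone Tn := by
    intro m n hmn
    simp only [hTn]
    have hm2 : (0 : ℝ) < (m : ℝ) + 2 := by positivity
    have hmn' : (m : ℝ) + 2 ≤ (n : ℝ) + 2 := by exact_mod_cast Nat.add_le_add_right hmn 2
    have := div_le_div_of_nonneg_left hT.le hm2 hmn'
    linarith
  -- the bound on each closed slab
  have hslab : ∀ n, ∫⁻ t in Ioo 0 (Tn n), eLpNorm (u t) ∞ volume ≤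
      ENNReal.ofReal (K * (Real.sqrt E * T ^ (1 / 4 : ℝ) + E)) := by
    intro n
    have hsol' : IsClassicalNSSolutionOn (Icc 0 (Tn n)) ν 0 u p :=
      hsol.mono (Icc_subset_Ico_right (hTn_lt n)) (uniqueDiffOn_Icc (hTn_pos n))
    have hfe : ∃ C' : ℝ≥0, ∀ t ∈ Icc 0 (Tn n), ∫⁻ x, ‖u t x‖ₑ ^ 2 ≤ C' :=
      ⟨Real.toNNReal (2 * E), fun t ht =>
        PlanarEnergyAPriori.lintegral_enorm_sq_le_of_isLerayHopfOn hLH hν.le ⟨ht.1, ht.2.trans (hTn_lt n).le⟩⟩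
    refine (hspeed (hTn_pos n) hsol' hfe hE0 hE₀).trans (ENNReal.ofReal_le_ofReal ?_)
    have h14 : Tn n ^ (1 / 4 : ℝ) ≤ T ^ (1 / 4 : ℝ) :=
      Real.rpow_le_rpow (hTn_pos n).le (hTn_lt n).le (by norm_num)
    have hsE : 0 ≤ Real.sqrt E := Real.sqrt_nonneg E
    nlinarith [mul_le_mul_of_nonneg_left h14 hsE]
  -- exhaustion `(0, T) = ⋃ₙ (0, Tn n)`
  have hU : (⋃ n, Ioo 0 (Tn n)) = Ioo 0 T := by
    ext t
    simp only [mem_iUnion, mem_Ioo]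
    constructor
    · rintro ⟨n, h0, h1⟩
      exact ⟨h0, h1.trans (hTn_lt n)⟩
    · rintro ⟨h0, h1⟩
      -- `T - t > T/(n+2)` for `n` large
      obtain ⟨n, hn⟩ := exists_nat_gt (T / (T - t))
      refine ⟨n, h0, ?_⟩
      simp only [hTn]
      have hTt : 0 < T - t := sub_pos.2 h1
      have hn2 : T / (T - t) < (n : ℝ) + 2 := by linarith
      have : T / ((n : ℝ) + 2) < T - t := by
        rw [div_lt_iff₀ (by positivity)]
        rw [div_lt_iff₀ hTt] at hn2
        nlinarith
      linarith
  have hdir : Directed (· ⊆ ·) fun n => Ioo 0 (Tn n) :=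
    Monotone.directed_le fun m n hmn => Ioo_subset_Ioo le_rfl (hTn_mono hmn)
  rw [← hU, setLIntegral_iUnion_of_directed _ hdir]
  exact iSup_le hslab

/-- **The total speed of a blow-up solution is finite**: `∫₀ᵀ ‖u(t)‖_{L^∞} dt < ∞` for every
classical Leray–Hopf solution on `[0, T)`. [cite: Tao2011, Prop. 9.1] -/
theorem lintegral_eLpNorm_top_lt_top_of_classical (hν : 0 < ν) (hT : 0 < T)
    (hsol : IsClassicalNSSolutionOn (Ico 0 T) ν 0 u p) (hLH : IsLerayHopfOn T ν 0 (u 0) u) :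
    ∫⁻ t in Ioo 0 T, eLpNorm (u t) ∞ volume < ⊤ := by
  obtain ⟨K, -, h⟩ := exists_boundedTotalSpeed_Ico hν
  exact (h T hT u p hsol hLH).trans_lt ENNReal.ofReal_lt_top

/-! ### The `α = 1` rung: `(T - t)‖u(t)‖_∞` is frequently bounded -/

/-- `∫_{T-δ}^{T} dt/(T - t) = ∞` for `δ > 0` (lower Lebesgue integral). [folklore] -/
theorem lintegral_inv_sub_Ioo_eq_top (T : ℝ) {δ : ℝ} (hδ : 0 < δ) :
    ∫⁻ t in Ioo (T - δ) T, ENNReal.ofReal ((T - t)⁻¹) = ⊤ := by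
  refine eq_top_iff.2 (le_of_forall_lt fun M hM => ?_)
  have hMtop : M ≠ ⊤ := hM.ne
  set m : ℝ := M.toReal with hm
  have hm0 : 0 ≤ m := ENNReal.toReal_nonneg
  set a : ℝ := δ * Real.exp (-(m + 1)) with ha
  have ha0 : 0 < a := by positivity
  have haδ : a < δ := by
    have : Real.exp (-(m + 1)) < 1 := Real.exp_lt_one_iff.2 (by linarith)
    rw [ha]; nlinarith
  have hlog : Real.log (δ / a) = m + 1 := by
    have : δ / a = Real.exp (m + 1) := by
      rw [ha, Real.exp_neg]
      field_simp
    rw [this, Real.log_exp]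
  -- the integral over `(T - δ, T - a]` is `log (δ / a)`
  have hcont : ContinuousOn (fun t : ℝ => (T - t)⁻¹) (Icc (T - δ) (T - a)) :=
    (continuousOn_const.sub continuousOn_id).inv₀ fun t ht => by
      have : t ≤ T - a := ht.2
      show T - t ≠ 0
      exact ne_of_gt (by linarith)
  have hint : IntegrableOn (fun t : ℝ => (T - t)⁻¹) (Ioc (T - δ) (T - a)) :=
    (hcont.integrableOn_Icc).mono_set Ioc_subset_Icc_self
  have hnn : 0 ≤ᵐ[volume.restrict (Ioc (T - δ) (T - a))] fun t : ℝ => (T - t)⁻¹ := by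
    refine (ae_restrict_iff' measurableSet_Ioc).2 (ae_of_all _ fun t ht => ?_)
    have : t ≤ T - a := ht.2
    exact inv_nonneg.2 (by linarith)
  have hval : ∫⁻ t in Ioc (T - δ) (T - a), ENNReal.ofReal ((T - t)⁻¹) =
      ENNReal.ofReal (Real.log (δ / a)) := by
    rw [← ofReal_integral_eq_lintegral_ofReal hint hnn, ← intervalIntegral.integral_of_le (by linarith),
      intervalIntegral.integral_comp_sub_left (fun x : ℝ => x⁻¹) T]
    simp only [sub_sub_cancel]
    rw [integral_inv_of_pos ha0 hδ]
  calc M = ENNReal.ofReal m := (ENNReal.ofReal_toReal hMtop).symm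
    _ < ENNReal.ofReal (m + 1) := by
        rw [ENNReal.ofReal_lt_ofReal_iff_of_nonneg hm0]; linarith
    _ = ∫⁻ t in Ioc (T - δ) (T - a), ENNReal.ofReal ((T - t)⁻¹) := by rw [hval, hlog]
    _ ≤ ∫⁻ t in Ioo (T - δ) T, ENNReal.ofReal ((T - t)⁻¹) :=
        lintegral_mono_set fun t ht => ⟨ht.1, lt_of_le_of_lt ht.2 (by linarith)⟩

/-- **The `α = 1` rung of the rate chain** (Foias–Guillopé–Temam's `L¹_t L^∞_x` bound read
pointwise): for a classical solution of unforced Navier–Stokes on `ℝ³ × [0, T)`, Leray–Hopf from its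
datum, and every `C > 0`, FREQUENTLY as `t ↑ T` the whole slice obeys `‖u(t, x)‖ ≤ C/(T - t)` —
i.e. `lim inf_{t↑T} (T - t)‖u(t)‖_∞ = 0`; in particular no blow-up sustains the linear rate.
(Otherwise `‖u(t)‖_{L^∞} > C/(T - t)` on a final interval — the slices are continuous, so a large
value at one point bounds the essential supremum from below — and `∫ dt/(T - t) = ∞` contradicts the
bounded total speed.) [cite: Tao2011, Prop. 9.1] -/
theorem frequently_linearRate_of_classical (hν : 0 < ν) (hT : 0 < T)
    (hsol : IsClassicalNSSolutionOn (Ico 0 T) ν 0 u p) (hLH : IsLerayHopfOn T ν 0 (u 0) u)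
    {C : ℝ} (hC : 0 < C) :
    ∃ᶠ t in 𝓝[<] T, ∀ x, ‖u t x‖ ≤ C / (T - t) := by
  by_contra hnot
  rw [not_frequently] at hnot
  -- eventually some point violates the bound; extract a final interval `(T - δ, T)`
  obtain ⟨l, hlT, hl⟩ := mem_nhdsLT_iff_exists_Ioo_subset.1 (hnot.and (Ioo_mem_nhdsLT hT))
  set δ : ℝ := T - max l 0 with hδ
  have hδ0 : 0 < δ := by
    simp only [hδ]
    have := max_lt hlT hT
    linarith
  have hsub : Ioo (T - δ) T ⊆ Ioo l T ∩ Ioo 0 T := fun t ht => by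
    simp only [hδ, sub_sub_cancel] at ht
    exact ⟨⟨(le_max_left _ _).trans_lt ht.1, ht.2⟩, ⟨(le_max_right _ _).trans_lt ht.1, ht.2⟩⟩
  -- on that interval `‖u(t)‖_{L^∞} ≥ C/(T - t)`
  have hlow : ∀ t ∈ Ioo (T - δ) T, ENNReal.ofReal (C * (T - t)⁻¹) ≤ eLpNorm (u t) ∞ volume := by
    intro t ht
    obtain ⟨⟨hx, -⟩, ht0⟩ := (show t ∈ _ from hl (hsub ht).1), (hsub ht).2
    obtain ⟨x, hx⟩ := not_forall.1 hx
    have hlt : C / (T - t) < ‖u t x‖ := lt_of_not_ge hx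
    have hcont : Continuous (u t) := (hsol.contDiff_velocity ⟨ht0.1.le, ht0.2⟩).continuous
    calc ENNReal.ofReal (C * (T - t)⁻¹) ≤ ENNReal.ofReal ‖u t x‖ :=
          ENNReal.ofReal_le_ofReal (by rw [← div_eq_mul_inv]; exact hlt.le)
      _ = ‖u t x‖ₑ := ofReal_norm _
      _ ≤ eLpNorm (u t) ∞ volume := FunctionSpaces.enorm_le_eLpNorm_top_of_continuous volume hcont x
  -- integrate: the left side diverges, the right side is finite
  have hdiv : ∫⁻ t in Ioo (T - δ) T, ENNReal.ofReal (C * (T - t)⁻¹) = ⊤ := by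
    have h1 : ∫⁻ t in Ioo (T - δ) T, ENNReal.ofReal (C * (T - t)⁻¹) =
        ENNReal.ofReal C * ∫⁻ t in Ioo (T - δ) T, ENNReal.ofReal ((T - t)⁻¹) := by
      rw [← lintegral_const_mul' _ _ ENNReal.ofReal_ne_top]
      refine setLIntegral_congr_fun measurableSet_Ioo fun t ht => ?_
      rw [ENNReal.ofReal_mul hC.le]
    rw [h1, lintegral_inv_sub_Ioo_eq_top T hδ0, ENNReal.mul_top (ENNReal.ofReal_pos.2 hC).ne']
  have hfin := lintegral_eLpNorm_top_lt_top_of_classical hν hT hsol hLH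
  have hle : ∫⁻ t in Ioo (T - δ) T, ENNReal.ofReal (C * (T - t)⁻¹) ≤
      ∫⁻ t in Ioo 0 T, eLpNorm (u t) ∞ volume :=
    (setLIntegral_mono_ae' measurableSet_Ioo (ae_of_all _ hlow)).trans
      (lintegral_mono_set fun t ht => (hsub ht).2)
  rw [hdiv] at hle
  exact (top_le_iff.1 hle ▸ hfin).ne rfl

/-- **No blow-up sustains the linear rate**: for a classical Leray–Hopf solution on `[0, T)` and
`c > 0` it is NOT the case that eventually `‖u(t)‖ ≥ c/(T - t)` somewhere on each slice — the
negation-free reading of `frequently_linearRate_of_classical` used by rate-chain arguments.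
[cite: Tao2011, Prop. 9.1] -/
theorem not_eventually_linearRate_below_of_classical (hν : 0 < ν) (hT : 0 < T)
    (hsol : IsClassicalNSSolutionOn (Ico 0 T) ν 0 u p) (hLH : IsLerayHopfOn T ν 0 (u 0) u)
    {c : ℝ} (hc : 0 < c) :
    ¬ ∀ᶠ t in 𝓝[<] T, ∃ x, c / (T - t) < ‖u t x‖ := by
  intro h
  have hf := frequently_linearRate_of_classical hν hT hsol hLH hc
  have hff : ∃ᶠ t in 𝓝[<] T, False :=
    (hf.and_eventually h).mono fun t ht => by
      obtain ⟨h1, x, hx⟩ := ht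
      exact (not_lt.2 (h1 x)) hx
  exact frequently_false _ hff

end Summit.NavierStokesRegularity.NavierStokesRegularity.Theorems.TypeIliouvilleNoTypeII.RateChain

end
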